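import Summits.BirchSwinnertonDyer.Rank1Residual.Additive.StabilisedDualSideTransport
import HarnessLib

/-!
# The count (C) AT FINITE LEVEL: `[H¹_𝓖(K, E[p^m]) : H¹_{𝓚[v₀ ↦ 0]}(K, E[p^m])] · p^{n−ν} =
# #(p^t·C) · ∏_{ℓ ∈ T} [𝓖_ℓ : 𝓚_ℓ]` from Poitou–Tate (file 58), the Weil transport (file 62) and the
# stabilised dual side (files 60–61) (cell `b2b-bsdres`, CLASS-CLOSURE lane, class O10 — x1b GEN 37,
# class lead; file 63 of the series: bricks B5 + B6 + B7 of the global count (C) ASSEMBLED at finite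
# level `p^m`, with every remaining input displayed as a hypothesis)

HONEST FRAMING (cell `b2b-bsdres`, run/shared/lean/b2b/bsd-rank1-residual/, verbatim in every
file): the goal of the cell is to DELETE the COMBINATION-SHAPED residual classes of the
Birch–Swinnerton-Dyer formula for ALL analytic-rank `≤ 1` elliptic curves over `ℚ` — "full BSD
formula for every rank `≤ 1` curve in class `C`" assembled STRICTLY from published theorems — so
that the rank-`≤ 1` remainder becomes exactly the CONSTRUCTION-SHAPED classes, which are TYPED
(missing-input `Prop`s), NOT attempted. This is not "finishing BSD". CLASS-CLOSURE lane: prove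
what is provable now; shrink each hard class to its core with data; no claim beyond stated classes;
research routes on CONSTRUCTION-SHAPED X12 / O10; census / instrument output = EVIDENCE / conjecture
items, NEVER a Literature fact; `RESIDUAL-MAP.md` marks change only by signed lines. THIS FILE:
TOOL THEOREMS ONLY — no definition, no named Literature fact, no Summits-side fact `def … : Prop`,
no `sorry`, axioms standard; CONDITIONAL exactly as files 58 / 62 on a family `inv` of local
invariant maps with the properties of the tree's named fact `poitouTate_selmerStructure_duality`
(`IsPerfect`, `SumLocalTermEqZero`, `SelmerComplement`) and on the residual self-duality of the
Kummer structure (`hsd`), and on the ARITHMETIC INPUTS of the count listed below — all HYPOTHESES;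
nothing is booked; no label / mark / count / sub-cell moves; (C1_η), (C2_η-GZ), (C3_η) stay typed as
filed (cc-typer-6's pen); O10 stays OPEN / CONSTRUCTION-SHAPED; nothing about `BSD(W, p)` of any pair
is claimed.

## What (x1b GEN 36 note §2 "the level-`n` dictionary for (C)"; GEN 37 files 60–62)

For an elliptic curve `E = W` over a number field `K`, `n = p^m`, the Kummer structure `𝓚` on `E[n]`,
a finite place `v₀ = w₀` (the place above `p` in (C)), a finite set `T` of other finite places (the
bad places), a local condition `C ≤ H¹(K_{v₀}, E[n])` (the level-`∞` signed condition `C_m`) and the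
structure `𝓖 = 𝓚[v₀ ↦ p^t·C][ℓ ↦ 𝓖_ℓ ⊇ 𝓚_ℓ, ℓ ∈ T]` (`H¹_𝓖 ≅ A₀`; `𝓕 = 𝓚[v₀ ↦ 0]`, `H¹_𝓕 ≅ S₀`):

* `dualTransported_eq_comap_nsmul` — `w⁻¹((p^t·C)^*) = [p^t]⁻¹ w⁻¹(C^*)` at `v₀`;
* `selmerGroup_kummer_eq_inf`, `selmerGroup_update_bot_eq_inf_ker` — `Sel^{(n)} = R ∩ loc_{v₀}⁻¹ 𝓚_{v₀}`,
  `H¹_{𝓚[v₀ ↦ 0]} = R ∩ ker loc_{v₀}` (`R = H¹_{𝓚[v₀ ↦ ⊤]}`);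
* **`relIndex_mul_prime_pow_eq_card_mul_prod`** — THE COUNT AT FINITE LEVEL: under the inputs
  (i) `[R : H¹_{𝓚[v₀ ↦ 0]}] = p^m` (the relaxed/strict Kummer count at `v₀`: X5
  `relIndex_kummer_update_bot_update_top_eq` `= #E(K_{v₀})[p^m] · #(𝓞_{v₀}/p^m)`, `= p^m` for `K = ℚ`,
  `E(ℚ_p)[p] = 0`), (ii) a class `g ∈ Sel^{(p^m)}(E/K)` of order `p^m` with `ord(loc_{v₀} g) = p^{m−ν}`
  (`g = κ_m(P)`, `E(K)/p^m = ℤ/p^m·P`, `loc_p κ(P) = p^ν u κ(Q)`), (iii) `p^e · Sel^{(p^m)}(E/K) ⊆ ℤg`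
  (`p^e Ш(E/K)[p^∞] = 0`), (iv) TRANSVERSALITY `𝓚_{v₀} ∩ w⁻¹(C^*) = 0` (the Kummer line meets the
  annihilator of `C_m` trivially: `C_m ⊕ L_m = H¹(ℚ_p, W[p^m])`, B3 + (T)), (v) the idle-condition
  inputs at `ℓ ∈ T` (`loc_ℓ` sends `R[p^t]` and `p^{m−t−ν} g` into `w⁻¹(𝓖_ℓ^*)`), and
  `ν + e ≤ t`, `t + ν ≤ m`:
  **`[H¹_𝓖 : H¹_{𝓚[v₀ ↦ 0]}] · p^{m−t−ν} = #(p^t·C) · ∏_{ℓ ∈ T} [𝓖_ℓ : 𝓚_ℓ]`.**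
  With `#C = p^m` cyclic (B3: `#(p^t·C) = p^{m−t}`) and `[𝓖_ℓ : 𝓚_ℓ] = #𝒦_{ℓ,0} = p^{ord_p c_ℓ}` (B4)
  this reads `#(A₀ ⧸ S₀) = p^ν · Tam(W)^{(p)}` — the count (C) — once `H¹_𝓖 ≅ A₀`, `H¹_𝓕 ≅ S₀`
  (the bridge, not here).

NOT here: the bridge; B3; the discharges of (i)–(v) for the `p*`-twist `W` of (C3_η) (successor files).

References: [GreenbergLNM1716] §4 (proof of Thm. 4.1, pp. 98–103); [Howard2004HeegnerKolyvagin]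
Thm. 2.1.11; [MilneADT2006] I Thm. 4.10, §6 (6.14), Lemma 6.15; [Kobayashi2003] Thm. 6.2, Thm. 9.3.
-/

noncomputable section

open scoped Classical

universe u

open CategoryTheory Field Function NumberField IsDedekindDomain WeierstrassCurve
open Literature.NumberTheory.EllipticCurves
open Literature.NumberTheory.GaloisRepresentations
open Literature.NumberTheory.GaloisRepresentations.DiscreteGaloisModule (mu MuCarrier SelmerStructure
  localTatePairingZMod tateDual localMap)
open Literature.NumberTheory.GaloisCohomology
open Summit.BirchSwinnertonDyer.Rank1Residual.X11b.LocBridge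
open Summit.BirchSwinnertonDyer.Rank1Residual.X11b.Levels
open Summit.BirchSwinnertonDyer.Rank1Residual.X5.SelfDualCount
open Summit.BirchSwinnertonDyer.Rank1Residual.Additive.StabilisedDualTransport
open scoped ContRepresentation

namespace Summit.BirchSwinnertonDyer.Rank1Residual.Additive.DefectCountFiniteLevel


variable {K : Type u} [Field K] [NumberField K] (W : WeierstrassCurve K) (n : ℕ) [NeZero n]
  [W.IsElliptic] [Finite (geomTorsion W n)]
variable (e : geomTorsion W n → geomTorsion W n → AlgebraicClosure K)
  (hμ : ∀ S T, e S T ^ n = 1)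
  (hadd₁ : ∀ S₁ S₂ T, e (S₁ + S₂) T = e S₁ T * e S₂ T)
  (hadd₂ : ∀ S T₁ T₂, e S (T₁ + T₂) = e S T₁ * e S T₂)
  (hgal : ∀ (σ : absoluteGaloisGroup K) (S T : geomTorsion W n), σ • e S T = e (σ • S) (σ • T))
  (hnondeg : ∀ T, (∀ S, e S T = 1) → T = 0)
  (inv : LocalInvariants K n)

/-! ## §1. Bookkeeping: the transported dual of `p^t·C`; `Sel^{(n)}` and `H¹_{𝓚[v₀ ↦ 0]}` inside `R` -/

/-- **`w⁻¹((k·C)^*) = [k]⁻¹ w⁻¹(C^*)`** at a place `v₀`: for a structure `𝓖` with `𝓖_{v₀} = k·C`,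
`(w⁻¹𝓖^*)_{v₀}` is the preimage under multiplication by `k` of `w⁻¹(C^*)` (file 62
`dualLocalCondition_map_nsmul` and `H¹(w_{v₀})` additive). [cite: Sakamoto2024, §3.1.2 (p. 924)]
[cite: Howard2004HeegnerKolyvagin, Def. 2.1.6 (arXiv:1202.6340 p. 5)] -/
theorem dualTransported_eq_comap_nsmul (𝓖 : SelmerStructure (W.torsionGaloisModule n))
    (v₀ : Place K) (C : AddSubgroup (galoisCohomology ((W.torsionGaloisModule n).toLocal v₀) 1))
    (k : ℕ) (h𝓖v₀ : 𝓖 v₀ = C.map (nsmulAddMonoidHom k)) :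
    inv.dualTransported 𝓖 (weilDualIntertwining W n e hμ hadd₁ hadd₂ hgal) v₀ =
      ((inv.dualLocalCondition (W.torsionGaloisModule n) v₀ C).comap
          (localMap (weilDualIntertwining W n e hμ hadd₁ hadd₂ hgal) v₀)).comap
        (nsmulAddMonoidHom k) := by
  ext y
  rw [LocalInvariants.mem_dualTransported_iff, LocalInvariants.dualSelmerStructure_apply, h𝓖v₀,
    dualLocalCondition_map_nsmul, AddSubgroup.mem_comap, AddSubgroup.mem_comap, AddSubgroup.mem_comap,
    nsmulAddMonoidHom_apply, nsmulAddMonoidHom_apply, map_nsmul]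

omit [NeZero n] [W.IsElliptic] [Finite (geomTorsion W n)] in
/-- `Sel^{(n)}(E/K) = H¹_𝓚 = R ∩ loc_{v₀}⁻¹(𝓚_{v₀})` with `R = H¹_{𝓚[v₀ ↦ ⊤]}` (X11b
`PoitouTateCounting.selmerGroup_eq_inf_comap`). [folklore] -/
theorem selmerGroup_kummer_eq_inf (v₀ : Place K) :
    (W.kummerSelmerStructure (n : ℤ) : SelmerStructure (W.torsionGaloisModule n)).selmerGroup =
      (SelmerStructure.selmerGroup (Function.update (W.kummerSelmerStructure (n : ℤ)) v₀ ⊤ :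
          SelmerStructure (W.torsionGaloisModule n))) ⊓
        (W.kummerSelmerStructure (n : ℤ) v₀).comap
          (galoisCohomology.localization (W.torsionGaloisModule n) v₀ 1) := by
  have h := X11b.PoitouTateCounting.selmerGroup_eq_inf_comap
    (𝓕 := (W.kummerSelmerStructure (n : ℤ) : SelmerStructure (W.torsionGaloisModule n)))
    (𝓖 := Function.update (W.kummerSelmerStructure (n : ℤ)) v₀ ⊤) (v₀ := v₀)
    (fun v => by
      by_cases hv : v = v₀
      · subst hv; rw [Function.update_self]; exact le_top
      · rw [Function.update_of_ne hv])
    (fun v hv => by rw [Function.update_of_ne hv])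
  exact h

omit [NeZero n] [W.IsElliptic] [Finite (geomTorsion W n)] in
/-- `H¹_{𝓚[v₀ ↦ 0]} = R ∩ ker loc_{v₀}` with `R = H¹_{𝓚[v₀ ↦ ⊤]}`. [folklore] -/
theorem selmerGroup_update_bot_eq_inf_ker (v₀ : Place K) :
    (SelmerStructure.selmerGroup (Function.update (W.kummerSelmerStructure (n : ℤ)) v₀ ⊥ :
        SelmerStructure (W.torsionGaloisModule n))) =
      (SelmerStructure.selmerGroup (Function.update (W.kummerSelmerStructure (n : ℤ)) v₀ ⊤ :
          SelmerStructure (W.torsionGaloisModule n))) ⊓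
        (galoisCohomology.localization (W.torsionGaloisModule n) v₀ 1).ker := by
  have h := X11b.PoitouTateCounting.selmerGroup_eq_inf_comap
    (𝓕 := (Function.update (W.kummerSelmerStructure (n : ℤ)) v₀ ⊥ :
      SelmerStructure (W.torsionGaloisModule n)))
    (𝓖 := Function.update (W.kummerSelmerStructure (n : ℤ)) v₀ ⊤) (v₀ := v₀)
    (update_bot_le_update_top W n _ v₀) (fun v hv => update_bot_eq_update_top_of_ne W n _ v₀ v hv)
  rw [Function.update_self, AddMonoidHom.comap_bot] at h
  exact h

/-! ## §2. The count (C) at finite level -/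

include hnondeg in
/-- **THE COUNT (C) AT FINITE LEVEL `p^m`.**  `E = W` elliptic over a number field `K`; `n = p^m`;
`𝓚` the Kummer structure on `E[n]`, unramified outside `S ⊇ {v ∣ ∞} ∪ {v ∣ n} ∪ Ram(E[n])` and
residually self-dual (`hsd`); `inv` a Poitou–Tate family (`IsPerfect`, `SumLocalTermEqZero`,
`SelmerComplement`); `w₀ ∈ S` a finite place, `v₀ = w₀`; `T ⊆ S` a finite set of other finite places;
`C ≤ H¹(K_{v₀}, E[n])`; `𝓖` the structure `p^t·C` at `v₀`, `𝓖_ℓ ⊇ 𝓚_ℓ` at `ℓ ∈ T`, `𝓚` elsewhere;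
`R = H¹_{𝓚[v₀ ↦ ⊤]}`.  ARITHMETIC INPUTS (hypotheses): (i) `[R : H¹_{𝓚[v₀ ↦ 0]}] = p^m`;
(ii) `g ∈ Sel^{(n)}(E/K)` with `ord g = p^m`, `ord(loc_{v₀} g) = p^{m−ν}`, `ν ≤ m`;
(iii) `p^e · Sel^{(n)}(E/K) ⊆ ℤg`; (iv) `𝓚_{v₀} ∩ w⁻¹(C^*) = 0`; (v) at `ℓ ∈ T`, `loc_ℓ` sends
`{y ∈ R | p^t y = 0}` and `p^{m−t−ν} g` into `w⁻¹(𝓖_ℓ^*)`; `ν + e ≤ t`, `t + ν ≤ m`.  THEN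

  **`[H¹_𝓖 : H¹_{𝓚[v₀ ↦ 0]}] · p^{m−t−ν} = #(p^t·C) · ∏_{ℓ ∈ T} [𝓖_ℓ : 𝓚_ℓ]`.**

Proof: file 62 `relIndex_mul_relIndex_inf_eq_card_mul_prod` (Poitou–Tate product count with the dual
index read on `E[n]`) and file 61 `relIndex_dualSide_eq_prime_pow` (the dual index `= p^{m−t−ν}`),
glued by `dualTransported_eq_comap_nsmul`.  In (C) (`K = ℚ`, `v₀ = p`, `T` = bad primes,
`C = C_m ≅ ℤ/p^m` the level-`∞` signed condition, `𝓖_ℓ = 𝒦_{m,ℓ}`, `m = n' + t`): the right side is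
`p^{n'} · ∏_ℓ p^{ord_p c_ℓ}`, so `[H¹_𝓖 : H¹_𝓕] = p^ν · Tam(W)^{(p)}` = `#(A₀ ⧸ S₀)` by the bridge.
CONDITIONAL on the listed hypotheses; nothing booked. [cite: GreenbergLNM1716, §4 (pp. 98–103)]
[cite: Howard2004HeegnerKolyvagin, Thm. 2.1.11 (arXiv:1202.6340 p. 6)] [cite: MilneADT2006, I Thm. 4.10]
[cite: Kobayashi2003, Thm. 9.3 (p. 26)] -/
theorem relIndex_mul_prime_pow_eq_card_mul_prod (hperf : inv.IsPerfect)
    (hvan : inv.SumLocalTermEqZero) (hcomp : inv.SelmerComplement) {S : Finset (Place K)}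
    (hS : ∀ v : HeightOneSpectrum (𝓞 K), (Sum.inr v : Place K) ∉ S →
      ((n : ℕ) : 𝓞 K) ∉ v.asIdeal ∧ GaloisRep.IsUnramifiedAt v (W.torsionGaloisModule n))
    (h𝓚 : SelmerStructure.IsUnramifiedOutside (W.kummerSelmerStructure (n : ℤ) :
      SelmerStructure (W.torsionGaloisModule n)) S)
    (hsd : ∀ v, inv.dualTransported (W.kummerSelmerStructure (n : ℤ))
      (weilDualIntertwining W n e hμ hadd₁ hadd₂ hgal) v = W.kummerSelmerStructure (n : ℤ) v)
    {w₀ : HeightOneSpectrum (𝓞 K)} (hw₀ : (Sum.inr w₀ : Place K) ∈ S)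
    (T : Finset (HeightOneSpectrum (𝓞 K))) (hw₀T : w₀ ∉ T)
    (hT : ∀ w ∈ T, (Sum.inr w : Place K) ∈ S)
    (C : AddSubgroup (galoisCohomology ((W.torsionGaloisModule n).toLocal (Sum.inr w₀)) 1))
    {p m t ν eSha : ℕ} (hp : p.Prime) (hn : n = p ^ m)
    (𝓖 : SelmerStructure (W.torsionGaloisModule n))
    (h𝓖v₀ : 𝓖 (Sum.inr w₀) = C.map (nsmulAddMonoidHom (p ^ t)))
    (h𝓖T : ∀ w ∈ T, W.kummerSelmerStructure (n : ℤ) (Sum.inr w) ≤ 𝓖 (Sum.inr w))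
    (h𝓖off : ∀ v : Place K, v ≠ Sum.inr w₀ → (∀ w ∈ T, v ≠ Sum.inr w) →
      𝓖 v = W.kummerSelmerStructure (n : ℤ) v)
    -- (i) the relaxed/strict count at `v₀`
    (hcount : (SelmerStructure.selmerGroup (Function.update (W.kummerSelmerStructure (n : ℤ))
          (Sum.inr w₀) ⊥ : SelmerStructure (W.torsionGaloisModule n))).relIndex
        (SelmerStructure.selmerGroup (Function.update (W.kummerSelmerStructure (n : ℤ))
          (Sum.inr w₀) ⊤ : SelmerStructure (W.torsionGaloisModule n))) = p ^ m)
    -- (ii) the class `g = κ_m(P)`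
    {g : galoisCohomology (W.torsionGaloisModule n) 1}
    (hgSel : g ∈ (W.kummerSelmerStructure (n : ℤ) :
      SelmerStructure (W.torsionGaloisModule n)).selmerGroup)
    (hg : addOrderOf g = p ^ m)
    (hlocg : addOrderOf (galoisCohomology.localization (W.torsionGaloisModule n) (Sum.inr w₀) 1 g) =
      p ^ (m - ν)) (hνm : ν ≤ m)
    -- (iii) the `Ш`-exponent
    (hSha : ∀ s ∈ (W.kummerSelmerStructure (n : ℤ) :
      SelmerStructure (W.torsionGaloisModule n)).selmerGroup, p ^ eSha • s ∈ AddSubgroup.zmultiples g)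
    -- (iv) transversality of the Kummer line to `w⁻¹(C^*)`
    (hLD : W.kummerSelmerStructure (n : ℤ) (Sum.inr w₀) ⊓
      (inv.dualLocalCondition (W.torsionGaloisModule n) (Sum.inr w₀) C).comap
        (localMap (weilDualIntertwining W n e hμ hadd₁ hadd₂ hgal) (Sum.inr w₀)) = ⊥)
    (het : ν + eSha ≤ t) (htν : t + ν ≤ m)
    -- (v) the idle local conditions at `ℓ ∈ T`
    (hDt : ∀ w : ↥T, ∀ y ∈ (SelmerStructure.selmerGroup (Function.update
        (W.kummerSelmerStructure (n : ℤ)) (Sum.inr w₀) ⊤ : SelmerStructure (W.torsionGaloisModule n))),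
      p ^ t • y = 0 →
        galoisCohomology.localization (W.torsionGaloisModule n)
            (Sum.inr (w : HeightOneSpectrum (𝓞 K))) 1 y ∈
          inv.dualTransported 𝓖 (weilDualIntertwining W n e hμ hadd₁ hadd₂ hgal)
            (Sum.inr (w : HeightOneSpectrum (𝓞 K))))
    (hDg : ∀ w : ↥T,
      galoisCohomology.localization (W.torsionGaloisModule n)
          (Sum.inr (w : HeightOneSpectrum (𝓞 K))) 1 (p ^ (m - t - ν) • g) ∈
        inv.dualTransported 𝓖 (weilDualIntertwining W n e hμ hadd₁ hadd₂ hgal)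
          (Sum.inr (w : HeightOneSpectrum (𝓞 K)))) :
    (SelmerStructure.selmerGroup (Function.update (W.kummerSelmerStructure (n : ℤ)) (Sum.inr w₀) ⊥ :
          SelmerStructure (W.torsionGaloisModule n))).relIndex 𝓖.selmerGroup *
        p ^ (m - t - ν) =
      Nat.card (C.map (nsmulAddMonoidHom (p ^ t))) *
        ∏ w ∈ T, (W.kummerSelmerStructure (n : ℤ) (Sum.inr w)).relIndex (𝓖 (Sum.inr w)) := by
  -- file 62: Poitou–Tate with the dual index read on `E[n]`, the transported dual at `v₀` being
  -- `[p^t]⁻¹ w⁻¹(C^*)`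
  have h62 := relIndex_mul_relIndex_inf_eq_card_mul_prod W n e hμ hadd₁ hadd₂ hgal hnondeg inv hperf
    hvan hcomp hS h𝓚 hsd hw₀ T hw₀T hT 𝓖 h𝓖T h𝓖off
  rw [dualTransported_eq_comap_nsmul W n e hμ hadd₁ hadd₂ hgal inv 𝓖 (Sum.inr w₀) C (p ^ t) h𝓖v₀]
    at h62
  -- the inputs of file 61 in Selmer shape
  have hSel := selmerGroup_kummer_eq_inf W n (Sum.inr w₀)
  have hR0 : ∀ x ∈ (SelmerStructure.selmerGroup (Function.update (W.kummerSelmerStructure (n : ℤ))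
      (Sum.inr w₀) ⊤ : SelmerStructure (W.torsionGaloisModule n))), p ^ m • x = 0 := fun x _ => by
    rw [← hn]
    exact nsmul_continuousCohomology_one_eq_zero _ n
      (fun P : geomTorsion W n => AddSubgroup.torsionBy.nsmul P) x
  have hgR : g ∈ (SelmerStructure.selmerGroup (Function.update (W.kummerSelmerStructure (n : ℤ))
      (Sum.inr w₀) ⊤ : SelmerStructure (W.torsionGaloisModule n))) := by
    rw [hSel] at hgSel; exact hgSel.1
  have hgL : galoisCohomology.localization (W.torsionGaloisModule n) (Sum.inr w₀) 1 g ∈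
      W.kummerSelmerStructure (n : ℤ) (Sum.inr w₀) := by
    rw [hSel] at hgSel; exact AddSubgroup.mem_comap.mp hgSel.2
  have hcount' : ((SelmerStructure.selmerGroup (Function.update (W.kummerSelmerStructure (n : ℤ))
        (Sum.inr w₀) ⊤ : SelmerStructure (W.torsionGaloisModule n))) ⊓
        (galoisCohomology.localization (W.torsionGaloisModule n) (Sum.inr w₀) 1).ker).relIndex
      (SelmerStructure.selmerGroup (Function.update (W.kummerSelmerStructure (n : ℤ))
        (Sum.inr w₀) ⊤ : SelmerStructure (W.torsionGaloisModule n))) = p ^ m := by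
    rw [← selmerGroup_update_bot_eq_inf_ker W n (Sum.inr w₀)]; exact hcount
  have hSha' : ∀ s ∈ (SelmerStructure.selmerGroup (Function.update (W.kummerSelmerStructure (n : ℤ))
        (Sum.inr w₀) ⊤ : SelmerStructure (W.torsionGaloisModule n))) ⊓
      (W.kummerSelmerStructure (n : ℤ) (Sum.inr w₀)).comap
        (galoisCohomology.localization (W.torsionGaloisModule n) (Sum.inr w₀) 1),
      p ^ eSha • s ∈ AddSubgroup.zmultiples g := fun s hs =>
    hSha s (by rw [hSel]; exact hs)
  -- file 61: the dual-side index is `p^{m-t-ν}`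
  have h61 := StabilisedDual.relIndex_dualSide_eq_prime_pow
    (galoisCohomology.localization (W.torsionGaloisModule n) (Sum.inr w₀) 1)
    (W.kummerSelmerStructure (n : ℤ) (Sum.inr w₀))
    ((inv.dualLocalCondition (W.torsionGaloisModule n) (Sum.inr w₀) C).comap
      (localMap (weilDualIntertwining W n e hμ hadd₁ hadd₂ hgal) (Sum.inr w₀)))
    (SelmerStructure.selmerGroup (Function.update (W.kummerSelmerStructure (n : ℤ))
      (Sum.inr w₀) ⊤ : SelmerStructure (W.torsionGaloisModule n)))
    (fun w : ↥T => galoisCohomology.localization (W.torsionGaloisModule n)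
      (Sum.inr (w : HeightOneSpectrum (𝓞 K))) 1)
    (fun w : ↥T => inv.dualTransported 𝓖 (weilDualIntertwining W n e hμ hadd₁ hadd₂ hgal)
      (Sum.inr (w : HeightOneSpectrum (𝓞 K))))
    hp hR0 hgR hgL hg hlocg hνm hLD hcount' hSha' het htν hDt hDg
  rw [h61] at h62
  rw [h62, h𝓖v₀]

end Summit.BirchSwinnertonDyer.Rank1Residual.Additive.DefectCountFiniteLevel

end
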